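import Summits.QuantumFields.YangMills.Theorems.AllWindowsColdBoxBoxHighLineGhostTaylor

/-!
# T-S5.6 (6b) `ghostLogRatio_sub_le` — the DETERMINANT-RATIO hypothesis `h6b` of ✓`smallFieldInsideFP_of`: on the small-field set
# `|det F(U(a))| ≤ exp(C₇·t·H⁵)·|det F(U(a′))|` (planner ym-idea-2 g18 2026-08-29T19:54:19Z «w3: when 7d lands EXPORT the corollary»;
# STUB-PLAN-S5-STEP2 §2 (6b); LINE-19 S5 ⟨stmt-QuantumFields-24004⟩/⟨24335⟩)

Width seat `ym-line-sfw-p2-w3` (g40).  The binder shape is w4 g27's `h6b` of ✓`…SmallFieldInsideFP.smallFieldInsideFP_of` VERBATIM, so that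
`smallFieldInsideFP : SmallFieldInsideFP := smallFieldInsideFP_of actionSandwich ghostLogRatio_sub_le` is a one-liner.

Proof (the first-order version of ✓7d `ghostTaylor`, same landed inputs).  For `‖a_e‖ ≤ t`, `t·H² ≤ 1/2688`:
`F(U(a)) = F₁(1 + X)`, `X = X_A + X_B + X_R` (✓`fpOperator_edgeChart_sub_one`), `‖Xv‖ ≤ ½‖v‖` (✓`ghost_opBound`), so by ✓`LogDetHS.logDet_hs`
`log|det F(U(a))| − log|det F₁| = r₃ + tr X − ½ tr X²` with `|r₃| ≤ ⅓‖X‖²_HS`, `tr X = tr X_B + tr X_R` (✓`trace_ghostX_chartL`: no linear term),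
`|tr X_B| + |tr X_R| ≤ 216·C_G·|I|·t²` (✓`abs_trace_ghostX_le`), `|tr X²| ≤ ‖X‖²_HS ≤ 31·κ·t²` (✓`sum_sq_ghostX_le`, `κ = 331776·H⁴·C_r(1+log H)⁴`);
hence `|log|det F(U(a))| − log|det F₁|| ≤ K·H⁴·(1+log H)⁴·t²` (`abs_log_det_edgeChart_sub_le`).  With `(1 + log H)⁴ ≤ 16 H²` (`log H ≤ 2√H − 2`)
and `t ≤ c₇/H²` this is `≤ (C₇/2)·t·H⁵`, and two configurations compare through `F₁`.

Everything proved, no definitions, standard axioms.  HONEST LABEL: an input (6b) of the OPEN task T-S5.6 of STEP 2 of the XL stub S5 of a critic-PASSed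
DRAFT line; T-S5.6 by name, S5, U5, ⟨24004⟩ ⟨24335⟩ ⟨24336⟩ remain OPEN; no crux, rung or summit is proved; **the Yang–Mills mass gap is NOT proved
by this file.**
-/

set_option autoImplicit false

noncomputable section

open Matrix Finset
open scoped Matrix.Norms.Operator
open Literature.MathematicalPhysics.QuantumFieldTheory.Balaban1983to89.B10Eq18SigmaSU2 (su2Coord)
open Literature.MathematicalPhysics.QuantumFieldTheory.Balaban1983to89.B10Eq18SigmaSU2Haar (expPauli)
open Literature.MathematicalPhysics.QuantumFieldTheory.AxialGauge (boxEdges)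
open Literature.MathematicalPhysics.QuantumLattice (LGConfig ZdEdge)
open Literature.Probability.LatticeModels (Site dirichletMatrix)

namespace Summit.QuantumFields.YangMills.Theorems.AllWindowsColdBoxBoxHighLine

namespace GhostLogRatioProof

open GhostFP GhostTaylorProof

variable {H : ℕ}

/-- `(1 + log H)⁴ ≤ 16 H²` for `H ≥ 1` (`log H = 2 log √H ≤ 2(√H − 1)`). -/
theorem one_add_log_pow_four_le (H : ℕ) (hH : 1 ≤ H) : (1 + Real.log H) ^ 4 ≤ 16 * (H : ℝ) ^ 2 := by
  have hH' : (1 : ℝ) ≤ H := by exact_mod_cast hH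
  have hH0 : (0 : ℝ) ≤ H := by linarith
  have hs : 0 < Real.sqrt H := Real.sqrt_pos.2 (by linarith)
  have hlog : Real.log H = 2 * Real.log (Real.sqrt H) := by
    rw [Real.log_sqrt hH0]; ring
  have h1 : Real.log (Real.sqrt H) ≤ Real.sqrt H - 1 := Real.log_le_sub_one_of_pos hs
  have h2 : 1 + Real.log H ≤ 2 * Real.sqrt H := by rw [hlog]; linarith
  have h3 : 0 ≤ 1 + Real.log H := by linarith [Real.log_nonneg hH']
  calc (1 + Real.log H) ^ 4 ≤ (2 * Real.sqrt H) ^ 4 := pow_le_pow_left₀ h3 h2 4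
    _ = 16 * (Real.sqrt H ^ 2) ^ 2 := by ring
    _ = 16 * (H : ℝ) ^ 2 := by rw [Real.sq_sqrt hH0]

/-- **Per-configuration bound**: for `‖a_e‖ ≤ t`, `t·H² ≤ 1/2688`, the determinant of `F(U(a))` is non-zero and
`|log|det F(U(a))| − log|det F₁|| ≤ (8626176·C_r + 3456·C_G)·H⁴·(1+log H)⁴·t²`. -/
theorem abs_log_det_edgeChart_sub_le (hH : 1 ≤ H) {CG Cr : ℝ} (hCG : 0 ≤ CG) (hCr0 : 0 ≤ Cr)
    (hG0 : ∀ x z : ↥(interiorSites H), 0 ≤ (dirichletMatrix (interiorSites H))⁻¹ x z)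
    (hGC : ∀ x z : ↥(interiorSites H), (dirichletMatrix (interiorSites H))⁻¹ x z ≤ CG)
    (hcol : ∀ z : ↥(interiorSites H), ∑ y, ((dirichletMatrix (interiorSites H))⁻¹ y z) ^ 2 ≤ Cr * (1 + Real.log H) ^ 4)
    {t : ℝ} (a : LandauFree H → E3) (ht0 : 0 ≤ t) (htH : t * (H : ℝ) ^ 2 ≤ 1 / 2688) (hat : ∀ e, ‖a e‖ ≤ t) :
    (fpOperator H (edgeChart H a)).det ≠ 0 ∧
      |(Real.log |(fpOperator H (edgeChart H a)).det| - Real.log |(fpOperator H 1).det|)| ≤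
        (8626176 * Cr + 3456 * CG) * (H : ℝ) ^ 4 * (1 + Real.log H) ^ 4 * t ^ 2 := by
  have hH' : (1 : ℝ) ≤ H := by exact_mod_cast hH
  have hH0 : (0 : ℝ) ≤ H := Nat.cast_nonneg H
  have hlogH : 0 ≤ Real.log H := Real.log_nonneg hH'
  set L : ℝ := (1 + Real.log H) ^ 4 with hLdef
  have hL : 1 ≤ L := one_le_pow₀ (by linarith)
  have hL0 : 0 ≤ L := by linarith
  have hH2 : (1 : ℝ) ≤ (H : ℝ) ^ 2 := one_le_pow₀ hH'
  have ht1 : t ≤ 1 := by nlinarith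
  have ht2 : t ^ 2 ≤ 1 := pow_le_one₀ ht0 ht1
  have ht32 : t ^ 3 ≤ t ^ 2 := pow_le_pow_of_le_one ht0 ht1 (by norm_num)
  have ht42 : t ^ 4 ≤ t ^ 2 := pow_le_pow_of_le_one ht0 ht1 (by norm_num)
  have ht62 : t ^ 6 ≤ t ^ 2 := pow_le_pow_of_le_one ht0 ht1 (by norm_num)
  have ht20 : 0 ≤ t ^ 2 / 2 := div_nonneg (sq_nonneg t) (by norm_num)
  have hat' : ∀ e : ZdEdge 4, ‖freeVec H a e‖ ≤ t := fun e => SmallFieldPlaq.norm_freeVec_le (fun e => hat e) ht0 e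
  have hH4n : (0 : ℝ) ≤ 16 * (H : ℝ) ^ 4 := mul_nonneg (by norm_num) (pow_nonneg hH0 4)
  have ht3 : 0 ≤ t ^ 3 := pow_nonneg ht0 3
  have hCrL : 0 ≤ Cr * L := mul_nonneg hCr0 hL0
  set U := edgeChart H a with hU
  set F₁ := fpOperator H 1 with hF₁
  set X := F₁⁻¹ * (fpOperator H U - F₁) with hX
  set XA := ghostX H (chartL H a)
  set XB := ghostX H (chartQ H a)
  set XR := ghostX H (chartR H a)
  have hXsplit : X = XA + XB + XR := by
    rw [hX, hU, fpOperator_edgeChart_sub_one, Matrix.mul_add, Matrix.mul_add]; rfl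
  -- link sizes
  have hδU : ∀ e ∈ boxEdges 4 (2 * H + 1), ‖((U e : SU2) : Matrix (Fin 2) (Fin 2) ℂ) - 1‖ ≤ 4 * t := by
    intro e _
    have h := norm_coe_expPauli_sub_one_le (freeVec H a e) ((hat' e).trans ht1)
    exact h.trans (by linarith [hat' e])
  have hδA : ∀ e ∈ boxEdges 4 (2 * H + 1), ‖chartL H a e‖ ≤ 3 * t := fun e _ =>
    (norm_su2Coord_chart_le (freeVec H a e)).trans (by linarith [hat' e])
  have hδB : ∀ e ∈ boxEdges 4 (2 * H + 1), ‖chartQ H a e‖ ≤ t ^ 2 / 2 := fun e _ => by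
    refine (norm_quadScalar_le (freeVec H a e)).trans ?_
    have := hat' e
    have h0 := norm_nonneg (freeVec H a e)
    nlinarith
  have hδR : ∀ e ∈ boxEdges 4 (2 * H + 1), ‖chartR H a e‖ ≤ t ^ 3 := fun e _ => by
    refine (norm_chartRem_le (freeVec H a e) ((hat' e).trans ht1)).trans ?_
    exact pow_le_pow_left₀ (norm_nonneg _) (hat' e) 3
  -- operator bound and the Hilbert–Schmidt log-det expansion
  set ρ : ℝ := 1344 * (H : ℝ) ^ 2 * t with hρ
  have hρ0 : 0 ≤ ρ := mul_nonneg (mul_nonneg (by norm_num) (pow_nonneg hH0 2)) ht0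
  have hρ12 : ρ ≤ 1 / 2 := by rw [hρ]; nlinarith
  have hop : ∀ v, X *ᵥ v ⬝ᵥ X *ᵥ v ≤ ρ ^ 2 * (v ⬝ᵥ v) := by
    intro v
    have h := ghost_opBound hH U hδU v
    rw [hρ]
    calc X *ᵥ v ⬝ᵥ X *ᵥ v ≤ (336 * (H : ℝ) ^ 2 * (4 * t)) ^ 2 * (v ⬝ᵥ v) := h
      _ = (1344 * (H : ℝ) ^ 2 * t) ^ 2 * (v ⬝ᵥ v) := by ring
  obtain ⟨hdet1X, hlog⟩ := LogDetHS.logDet_hs X hρ0 hρ12 hop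
  -- sizes first (no matrix equalities in context yet: `positivity`-free anyway)
  have hnI16 : (Fintype.card ↥(interiorSites H) : ℝ) ≤ 16 * (H : ℝ) ^ 4 := by
    rw [Fintype.card_coe]; exact PhiTaylorProof.card_interiorSites_le H
  have hsA := sum_sq_ghostX_le hG0 hcol (chartL H a) hδA
  have hsB := sum_sq_ghostX_le hG0 hcol (chartQ H a) hδB
  have hsR := sum_sq_ghostX_le hG0 hcol (chartR H a) hδR
  have htrB := abs_trace_ghostX_le hG0 hCG hGC (chartQ H a) ht20 hδB
  have htrR := abs_trace_ghostX_le hG0 hCG hGC (chartR H a) ht3 hδR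
  generalize hcard : (Fintype.card ↥(interiorSites H) : ℝ) = nI at hnI16 hsA hsB hsR htrB htrR
  set κ : ℝ := 20736 * (16 * (H : ℝ) ^ 4) * (Cr * L) with hκ
  have hκ0 : 0 ≤ κ := by rw [hκ]; exact mul_nonneg (mul_nonneg (by norm_num) hH4n) hCrL
  have hsA' : ∑ p, ∑ q, XA p q ^ 2 ≤ 9 * κ * t ^ 2 := by
    have h0 : (0 : ℝ) ≤ 20736 * (3 * t) ^ 2 := mul_nonneg (by norm_num) (sq_nonneg _)
    have h1 : 20736 * (3 * t) ^ 2 * nI * (Cr * L) ≤ 20736 * (3 * t) ^ 2 * (16 * (H : ℝ) ^ 4) * (Cr * L) :=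
      mul_le_mul_of_nonneg_right (mul_le_mul_of_nonneg_left hnI16 h0) hCrL
    refine (hsA.trans h1).trans (le_of_eq ?_)
    rw [hκ]; ring
  have hsB' : ∑ p, ∑ q, XB p q ^ 2 ≤ κ * t ^ 4 / 4 := by
    have h0 : (0 : ℝ) ≤ 20736 * (t ^ 2 / 2) ^ 2 := mul_nonneg (by norm_num) (sq_nonneg _)
    have h1 : 20736 * (t ^ 2 / 2) ^ 2 * nI * (Cr * L) ≤ 20736 * (t ^ 2 / 2) ^ 2 * (16 * (H : ℝ) ^ 4) * (Cr * L) :=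
      mul_le_mul_of_nonneg_right (mul_le_mul_of_nonneg_left hnI16 h0) hCrL
    refine (hsB.trans h1).trans (le_of_eq ?_)
    rw [hκ]; ring
  have hsR' : ∑ p, ∑ q, XR p q ^ 2 ≤ κ * t ^ 6 := by
    have h0 : (0 : ℝ) ≤ 20736 * (t ^ 3) ^ 2 := mul_nonneg (by norm_num) (sq_nonneg _)
    have h1 : 20736 * (t ^ 3) ^ 2 * nI * (Cr * L) ≤ 20736 * (t ^ 3) ^ 2 * (16 * (H : ℝ) ^ 4) * (Cr * L) :=
      mul_le_mul_of_nonneg_right (mul_le_mul_of_nonneg_left hnI16 h0) hCrL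
    refine (hsR.trans h1).trans (le_of_eq ?_)
    rw [hκ]; ring
  have htrB' : |XB.trace| ≤ 72 * CG * (16 * (H : ℝ) ^ 4) * t ^ 2 := by
    refine htrB.trans ?_
    have h0 : 0 ≤ 144 * CG * (t ^ 2 / 2) := mul_nonneg (mul_nonneg (by norm_num) hCG) ht20
    calc 144 * CG * (t ^ 2 / 2) * nI ≤ 144 * CG * (t ^ 2 / 2) * (16 * (H : ℝ) ^ 4) := mul_le_mul_of_nonneg_left hnI16 h0
      _ = 72 * CG * (16 * (H : ℝ) ^ 4) * t ^ 2 := by ring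
  have htrR' : |XR.trace| ≤ 144 * CG * (16 * (H : ℝ) ^ 4) * t ^ 2 := by
    refine htrR.trans ?_
    have h0 : 0 ≤ 144 * CG * t ^ 3 := mul_nonneg (mul_nonneg (by norm_num) hCG) ht3
    calc 144 * CG * t ^ 3 * nI ≤ 144 * CG * t ^ 3 * (16 * (H : ℝ) ^ 4) := mul_le_mul_of_nonneg_left hnI16 h0
      _ = 144 * CG * (16 * (H : ℝ) ^ 4) * t ^ 3 := by ring
      _ ≤ 144 * CG * (16 * (H : ℝ) ^ 4) * t ^ 2 :=
          mul_le_mul_of_nonneg_left ht32 (mul_nonneg (mul_nonneg (by norm_num) hCG) hH4n)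
  -- the total Hilbert–Schmidt size
  have hA0 : 0 ≤ ∑ p, ∑ q, XA p q ^ 2 := Finset.sum_nonneg fun p _ => Finset.sum_nonneg fun q _ => sq_nonneg _
  have hB0 : 0 ≤ ∑ p, ∑ q, XB p q ^ 2 := Finset.sum_nonneg fun p _ => Finset.sum_nonneg fun q _ => sq_nonneg _
  have hR0 : 0 ≤ ∑ p, ∑ q, XR p q ^ 2 := Finset.sum_nonneg fun p _ => Finset.sum_nonneg fun q _ => sq_nonneg _
  have hsX : ∑ p, ∑ q, X p q ^ 2 ≤ 31 * κ * t ^ 2 := by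
    have h1 : ∑ p, ∑ q, X p q ^ 2 ≤ 3 * (∑ p, ∑ q, XA p q ^ 2 + ∑ p, ∑ q, XB p q ^ 2 + ∑ p, ∑ q, XR p q ^ 2) := by
      rw [hXsplit]; exact sum_sq_add₃_le XA XB XR
    have h4 : κ * t ^ 4 ≤ κ * t ^ 2 := mul_le_mul_of_nonneg_left ht42 hκ0
    have h6 : κ * t ^ 6 ≤ κ * t ^ 2 := mul_le_mul_of_nonneg_left ht62 hκ0
    have h7 : 0 ≤ κ * t ^ 2 := mul_nonneg hκ0 (sq_nonneg t)
    linarith only [h1, hsA', hsB', hsR', h4, h6, h7]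
  have hX0 : 0 ≤ ∑ p, ∑ q, X p q ^ 2 := Finset.sum_nonneg fun p _ => Finset.sum_nonneg fun q _ => sq_nonneg _
  -- `F(U) = F₁(1 + X)` and the log of the determinant
  have hF₁unit : IsUnit F₁.det := SpectralFloor.isUnit_det_fpOperator_one hH
  have hFU : fpOperator H U = F₁ * (1 + X) := by
    rw [hX, Matrix.mul_add, Matrix.mul_one, ← Matrix.mul_assoc, Matrix.mul_nonsing_inv _ hF₁unit, Matrix.one_mul]
    abel
  have hdetU : (fpOperator H U).det ≠ 0 := by
    rw [hFU, Matrix.det_mul]; exact mul_ne_zero hF₁unit.ne_zero hdet1X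
  have hlogdiff : Real.log |(fpOperator H U).det| - Real.log |F₁.det| = Real.log |(1 + X).det| := by
    rw [hFU, Matrix.det_mul, abs_mul, Real.log_mul (abs_ne_zero.2 hF₁unit.ne_zero) (abs_ne_zero.2 hdet1X)]
    ring
  refine ⟨hdetU, ?_⟩
  clear hdet1X hF₁unit hFU hdetU
  -- traces (from here on no `positivity`/`linarith`: matrix traces are in the context)
  have htrA : XA.trace = 0 := trace_ghostX_chartL a
  have htrX : X.trace = XB.trace + XR.trace := by rw [hXsplit, Matrix.trace_add, Matrix.trace_add, htrA, zero_add]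
  have htrXX : |(X * X).trace| ≤ ∑ p, ∑ q, X p q ^ 2 := by
    refine (abs_trace_mul_le_sqrt X X).trans (le_of_eq ?_)
    exact Real.sqrt_mul_self hX0
  have hident : Real.log |(1 + X).det| =
      (Real.log |(1 + X).det| - X.trace + (X * X).trace / 2) + (XB.trace + XR.trace) - (X * X).trace / 2 := by
    rw [htrX]; ring
  rw [hlogdiff, hident]
  have hr3 : |Real.log |(1 + X).det| - X.trace + (X * X).trace / 2| ≤ 1 / 3 * (∑ p, ∑ q, X p q ^ 2) := by
    refine hlog.trans (mul_le_mul_of_nonneg_right ?_ hX0)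
    -- `2ρ/3 ≤ 1/3`
    have : 2 * ρ ≤ 1 := by
      have h2 := mul_le_mul_of_nonneg_left hρ12 (by norm_num : (0 : ℝ) ≤ 2)
      rw [show (2 : ℝ) * (1 / 2) = 1 by norm_num] at h2
      exact h2
    exact div_le_div_of_nonneg_right this (by norm_num)
  have hfinal : |Real.log |(1 + X).det| - X.trace + (X * X).trace / 2 + (XB.trace + XR.trace) - (X * X).trace / 2| ≤
      1 / 3 * (∑ p, ∑ q, X p q ^ 2) + (72 * CG * (16 * (H : ℝ) ^ 4) * t ^ 2 + 144 * CG * (16 * (H : ℝ) ^ 4) * t ^ 2) +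
        1 / 2 * ∑ p, ∑ q, X p q ^ 2 := by
    have e1 : |(X * X).trace / 2| = 1 / 2 * |(X * X).trace| := by rw [abs_div, abs_two]; ring
    calc _ ≤ |Real.log |(1 + X).det| - X.trace + (X * X).trace / 2 + (XB.trace + XR.trace)| + |(X * X).trace / 2| := abs_sub _ _
      _ ≤ |Real.log |(1 + X).det| - X.trace + (X * X).trace / 2| + |XB.trace + XR.trace| + |(X * X).trace / 2| :=
          add_le_add (abs_add_le _ _) le_rfl
      _ ≤ 1 / 3 * (∑ p, ∑ q, X p q ^ 2) + (72 * CG * (16 * (H : ℝ) ^ 4) * t ^ 2 + 144 * CG * (16 * (H : ℝ) ^ 4) * t ^ 2) +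
            1 / 2 * ∑ p, ∑ q, X p q ^ 2 := by
          rw [e1]
          exact add_le_add (add_le_add hr3 ((abs_add_le _ _).trans (add_le_add htrB' htrR')))
            (mul_le_mul_of_nonneg_left htrXX (by norm_num))
  refine hfinal.trans ?_
  -- arithmetic: `(1/3 + 1/2)·31κ t² + 3456·CG·H⁴·t² ≤ (8626176 Cr + 3456 CG) H⁴ L t²`
  have hκt : (1 / 3 + 1 / 2) * (31 * κ * t ^ 2) ≤ 26 * κ * t ^ 2 := by
    have h7 : 0 ≤ κ * t ^ 2 := mul_nonneg hκ0 (sq_nonneg t)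
    linarith only [h7]
  have hκexp : 26 * κ * t ^ 2 = 8626176 * Cr * (H : ℝ) ^ 4 * L * t ^ 2 := by rw [hκ]; ring
  have hCGterm : 72 * CG * (16 * (H : ℝ) ^ 4) * t ^ 2 + 144 * CG * (16 * (H : ℝ) ^ 4) * t ^ 2 ≤ 3456 * CG * (H : ℝ) ^ 4 * L * t ^ 2 := by
    have h0 : 0 ≤ 3456 * CG * (H : ℝ) ^ 4 * t ^ 2 := mul_nonneg (mul_nonneg (mul_nonneg (by norm_num) hCG) (pow_nonneg hH0 4)) (sq_nonneg t)
    calc 72 * CG * (16 * (H : ℝ) ^ 4) * t ^ 2 + 144 * CG * (16 * (H : ℝ) ^ 4) * t ^ 2 = 3456 * CG * (H : ℝ) ^ 4 * t ^ 2 * 1 := by ring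
      _ ≤ 3456 * CG * (H : ℝ) ^ 4 * t ^ 2 * L := mul_le_mul_of_nonneg_left hL h0
      _ = 3456 * CG * (H : ℝ) ^ 4 * L * t ^ 2 := by ring
  have hsum : 1 / 3 * (∑ p, ∑ q, X p q ^ 2) + 1 / 2 * ∑ p, ∑ q, X p q ^ 2 ≤ (1 / 3 + 1 / 2) * (31 * κ * t ^ 2) := by
    rw [← add_mul]; exact mul_le_mul_of_nonneg_left hsX (by norm_num)
  calc 1 / 3 * (∑ p, ∑ q, X p q ^ 2) + (72 * CG * (16 * (H : ℝ) ^ 4) * t ^ 2 + 144 * CG * (16 * (H : ℝ) ^ 4) * t ^ 2) +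
        1 / 2 * ∑ p, ∑ q, X p q ^ 2
      = (1 / 3 * (∑ p, ∑ q, X p q ^ 2) + 1 / 2 * ∑ p, ∑ q, X p q ^ 2) +
          (72 * CG * (16 * (H : ℝ) ^ 4) * t ^ 2 + 144 * CG * (16 * (H : ℝ) ^ 4) * t ^ 2) := by ring
    _ ≤ 26 * κ * t ^ 2 + 3456 * CG * (H : ℝ) ^ 4 * L * t ^ 2 := add_le_add (hsum.trans hκt) hCGterm
    _ = (8626176 * Cr + 3456 * CG) * (H : ℝ) ^ 4 * (1 + Real.log H) ^ 4 * t ^ 2 := by rw [hκexp, hLdef]; ring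

end GhostLogRatioProof

open GhostFP GhostTaylorProof GhostLogRatioProof in
/-- ★ **T-S5.6 (6b), the determinant-ratio hypothesis `h6b` of ✓`smallFieldInsideFP_of`**: there are `C₇` and `c₇ > 0` such that for all
`H ≥ 1`, `0 ≤ t`, `t·H² ≤ c₇` and all `a, a′ ∈ smallField H t`, `|det F(U(a))| ≤ exp(C₇·t·H⁵)·|det F(U(a′))|`. -/
theorem ghostLogRatio_sub_le : ∃ C₇ c₇ : ℝ, 0 < c₇ ∧ ∀ H : ℕ, 1 ≤ H → ∀ t : ℝ, 0 ≤ t → t * (H : ℝ) ^ 2 ≤ c₇ →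
    ∀ a a' : LandauFree H → E3, a ∈ smallField H t → a' ∈ smallField H t →
      |(fpOperator H (edgeChart H a)).det| ≤ Real.exp (C₇ * t * (H : ℝ) ^ 5) * |(fpOperator H (edgeChart H a')).det| := by
  obtain ⟨CG₀, hK⟩ := ghostKernelDecay
  obtain ⟨Cr, hCr0, hrow⟩ := OrbitMapSurj.interiorGreen_row_sq_le
  set CG : ℝ := max CG₀ 0 with hCGdef
  have hCG : 0 ≤ CG := le_max_right _ _
  set Kc : ℝ := 8626176 * Cr + 3456 * CG with hKc
  have hKc0 : 0 ≤ Kc := by rw [hKc]; positivity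
  refine ⟨Kc, 1 / 2688, by norm_num, fun H hH t ht0 htH a a' ha ha' => ?_⟩
  have hG0 : ∀ x z : ↥(interiorSites H), 0 ≤ (dirichletMatrix (interiorSites H))⁻¹ x z := fun x z => (hK H hH x z).1
  have hGC : ∀ x z : ↥(interiorSites H), (dirichletMatrix (interiorSites H))⁻¹ x z ≤ CG := by
    intro x z
    have hd := GhostKernel.siteDist_nonneg (x : Site 4) (z : Site 4)
    have h1 : CG₀ / (1 + siteDist (x : Site 4) (z : Site 4)) ^ 2 ≤ CG / (1 + siteDist (x : Site 4) (z : Site 4)) ^ 2 :=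
      div_le_div_of_nonneg_right (le_max_left _ _) (by positivity)
    exact ((hK H hH x z).2.trans h1).trans (div_le_self hCG (one_le_pow₀ (by linarith only [hd])))
  have hcol : ∀ z : ↥(interiorSites H), ∑ y, ((dirichletMatrix (interiorSites H))⁻¹ y z) ^ 2 ≤ Cr * (1 + Real.log H) ^ 4 := by
    intro z
    have h := hrow H hH z
    rw [show (∑ y, ((dirichletMatrix (interiorSites H))⁻¹ y z) ^ 2) = ∑ y, ((dirichletMatrix (interiorSites H))⁻¹ z y) ^ 2 from
      Finset.sum_congr rfl fun y _ => by rw [green_symm]]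
    exact h
  obtain ⟨hda, hba⟩ := abs_log_det_edgeChart_sub_le hH hCG hCr0 hG0 hGC hcol a ht0 htH ha
  obtain ⟨hda', hba'⟩ := abs_log_det_edgeChart_sub_le hH hCG hCr0 hG0 hGC hcol a' ht0 htH ha'
  -- the common bound is `≤ (Kc/2)·t·H⁵`
  have hH' : (1 : ℝ) ≤ H := by exact_mod_cast hH
  have hH0 : (0 : ℝ) ≤ H := by linarith only [hH']
  have hL16 := one_add_log_pow_four_le H hH
  set B : ℝ := Kc * (H : ℝ) ^ 4 * (1 + Real.log H) ^ 4 * t ^ 2 with hB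
  have hB2 : 2 * B ≤ Kc * t * (H : ℝ) ^ 5 := by
    -- `2·Kc·H⁴·L·t² ≤ 2·Kc·H⁴·16H²·t·(c₇/H²) = Kc·(32/2688)·H⁴·t ≤ Kc·t·H⁵`
    have h1 : B ≤ Kc * (H : ℝ) ^ 4 * (16 * (H : ℝ) ^ 2) * t ^ 2 := by
      rw [hB]
      exact mul_le_mul_of_nonneg_right (mul_le_mul_of_nonneg_left hL16 (mul_nonneg hKc0 (pow_nonneg hH0 4))) (sq_nonneg t)
    have h2 : (H : ℝ) ^ 2 * t ≤ 1 / 2688 := by linarith only [htH]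
    have h3 : Kc * (H : ℝ) ^ 4 * (16 * (H : ℝ) ^ 2) * t ^ 2 = 16 * Kc * (H : ℝ) ^ 4 * t * ((H : ℝ) ^ 2 * t) := by ring
    have h4 : 16 * Kc * (H : ℝ) ^ 4 * t * ((H : ℝ) ^ 2 * t) ≤ 16 * Kc * (H : ℝ) ^ 4 * t * (1 / 2688) :=
      mul_le_mul_of_nonneg_left h2 (mul_nonneg (mul_nonneg (mul_nonneg (by norm_num) hKc0) (pow_nonneg hH0 4)) ht0)
    have h5 : (H : ℝ) ^ 4 ≤ (H : ℝ) ^ 5 := pow_le_pow_right₀ hH' (by norm_num)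
    have h6 : Kc * t * (H : ℝ) ^ 4 ≤ Kc * t * (H : ℝ) ^ 5 := mul_le_mul_of_nonneg_left h5 (mul_nonneg hKc0 ht0)
    have hnn : 0 ≤ Kc * t * (H : ℝ) ^ 5 := mul_nonneg (mul_nonneg hKc0 ht0) (pow_nonneg hH0 5)
    linarith only [h1, h3, h4, h6, hnn]
  -- compare through `F₁` (the log-determinants generalized to opaque reals before any arithmetic)
  have hA : 0 < |(fpOperator H (edgeChart H a)).det| := abs_pos.2 hda
  have hA' : 0 < |(fpOperator H (edgeChart H a')).det| := abs_pos.2 hda'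
  have hEa : |(fpOperator H (edgeChart H a)).det| = Real.exp (Real.log |(fpOperator H (edgeChart H a)).det|) := (Real.exp_log hA).symm
  have hEa' : |(fpOperator H (edgeChart H a')).det| = Real.exp (Real.log |(fpOperator H (edgeChart H a')).det|) :=
    (Real.exp_log hA').symm
  rw [hEa, hEa', mul_comm, ← Real.exp_add, Real.exp_le_exp]
  generalize Real.log |(fpOperator H (edgeChart H a)).det| = ℓa at hba
  generalize Real.log |(fpOperator H (edgeChart H a')).det| = ℓa' at hba'
  generalize Real.log |(fpOperator H 1).det| = ℓ₁ at hba hba'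
  have h1 := (abs_le.1 hba).2
  have h2 := (abs_le.1 hba').1
  linarith only [h1, h2, hB2]

open GhostFP GhostTaylorProof GhostLogRatioProof in
/-- ★ **6b, SHARP (quadratic) form** — the `h6b`-half of the recorded lift L5 («h6b without the `t·H⁵` coarsening»): there are `K` and `c > 0`
such that for `H ≥ 1`, `0 ≤ t`, `t·H² ≤ c` and `a, a′ ∈ smallField H t`,
`|det F(U(a))| ≤ exp(K·H⁴·(1+log H)⁴·t²)·|det F(U(a′))|` (twice the per-configuration bound `abs_log_det_edgeChart_sub_le`). -/
theorem ghostDetRatio_sq_le : ∃ K c : ℝ, 0 < c ∧ ∀ H : ℕ, 1 ≤ H → ∀ t : ℝ, 0 ≤ t → t * (H : ℝ) ^ 2 ≤ c →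
    ∀ a a' : LandauFree H → E3, a ∈ smallField H t → a' ∈ smallField H t →
      |(fpOperator H (edgeChart H a)).det| ≤
        Real.exp (K * (H : ℝ) ^ 4 * (1 + Real.log H) ^ 4 * t ^ 2) * |(fpOperator H (edgeChart H a')).det| := by
  obtain ⟨CG₀, hK⟩ := ghostKernelDecay
  obtain ⟨Cr, hCr0, hrow⟩ := OrbitMapSurj.interiorGreen_row_sq_le
  set CG : ℝ := max CG₀ 0 with hCGdef
  have hCG : 0 ≤ CG := le_max_right _ _
  refine ⟨2 * (8626176 * Cr + 3456 * CG), 1 / 2688, by norm_num, fun H hH t ht0 htH a a' ha ha' => ?_⟩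
  have hG0 : ∀ x z : ↥(interiorSites H), 0 ≤ (dirichletMatrix (interiorSites H))⁻¹ x z := fun x z => (hK H hH x z).1
  have hGC : ∀ x z : ↥(interiorSites H), (dirichletMatrix (interiorSites H))⁻¹ x z ≤ CG := by
    intro x z
    have hd := GhostKernel.siteDist_nonneg (x : Site 4) (z : Site 4)
    have h1 : CG₀ / (1 + siteDist (x : Site 4) (z : Site 4)) ^ 2 ≤ CG / (1 + siteDist (x : Site 4) (z : Site 4)) ^ 2 :=
      div_le_div_of_nonneg_right (le_max_left _ _) (by positivity)
    exact ((hK H hH x z).2.trans h1).trans (div_le_self hCG (one_le_pow₀ (by linarith only [hd])))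
  have hcol : ∀ z : ↥(interiorSites H), ∑ y, ((dirichletMatrix (interiorSites H))⁻¹ y z) ^ 2 ≤ Cr * (1 + Real.log H) ^ 4 := by
    intro z
    have h := hrow H hH z
    rw [show (∑ y, ((dirichletMatrix (interiorSites H))⁻¹ y z) ^ 2) = ∑ y, ((dirichletMatrix (interiorSites H))⁻¹ z y) ^ 2 from
      Finset.sum_congr rfl fun y _ => by rw [green_symm]]
    exact h
  obtain ⟨hda, hba⟩ := abs_log_det_edgeChart_sub_le hH hCG hCr0 hG0 hGC hcol a ht0 htH ha
  obtain ⟨hda', hba'⟩ := abs_log_det_edgeChart_sub_le hH hCG hCr0 hG0 hGC hcol a' ht0 htH ha'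
  have hA : 0 < |(fpOperator H (edgeChart H a)).det| := abs_pos.2 hda
  have hA' : 0 < |(fpOperator H (edgeChart H a')).det| := abs_pos.2 hda'
  have hEa : |(fpOperator H (edgeChart H a)).det| = Real.exp (Real.log |(fpOperator H (edgeChart H a)).det|) := (Real.exp_log hA).symm
  have hEa' : |(fpOperator H (edgeChart H a')).det| = Real.exp (Real.log |(fpOperator H (edgeChart H a')).det|) :=
    (Real.exp_log hA').symm
  rw [hEa, hEa', mul_comm, ← Real.exp_add, Real.exp_le_exp]
  have h3 : 2 * (8626176 * Cr + 3456 * CG) * (H : ℝ) ^ 4 * (1 + Real.log H) ^ 4 * t ^ 2 =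
      2 * ((8626176 * Cr + 3456 * CG) * (H : ℝ) ^ 4 * (1 + Real.log H) ^ 4 * t ^ 2) := by ring
  rw [h3]
  generalize (8626176 * Cr + 3456 * CG) * (H : ℝ) ^ 4 * (1 + Real.log H) ^ 4 * t ^ 2 = B at hba hba' ⊢
  generalize Real.log |(fpOperator H (edgeChart H a)).det| = ℓa at hba ⊢
  generalize Real.log |(fpOperator H (edgeChart H a')).det| = ℓa' at hba' ⊢
  generalize Real.log |(fpOperator H 1).det| = ℓ₁ at hba hba'
  have h1 := (abs_le.1 hba).2
  have h2 := (abs_le.1 hba').1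
  linarith only [h1, h2]

end Summit.QuantumFields.YangMills.Theorems.AllWindowsColdBoxBoxHighLine

end
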